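import Summits.MatrixMultiplication.MatrixMultiplication.Theses.HessianPlane
import Summits.MatrixMultiplication.MatrixMultiplication.Theorems.HessianPlaneHesseToCW
import Summits.MatrixMultiplication.MatrixMultiplication.Theorems.HessianPlaneCWPointAssembly

/-!
# `HessianPlane.Assembly` (stmt-MatrixMultiplication-4900) — proved

The assembly item of route `MatrixMultiplication/HessianPlane` is the implication
`HessianPlaneFlat → MatrixMultiplication`: flatness of the asymptotic rank on Nurmiev's Cartan
plane of `3×3×3` tensors (for all `(a,b,c)` and every `ε > 0`,
`R(u(a,b,c)^{⊠N}) = O(3^{(1+ε)N})`) implies `ω(ℂ) = 2`.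

Proof: composition of two theorems already in the tree —
* `hesseToCW_proof` (Theorems/HessianPlaneHesseToCW.lean, item stmt-MatrixMultiplication-4895):
  `HessianPlaneFlat` specialised to the CW point `(a,b,c) = (0,1,1)` gives the growth bound
  `R(T_cw,2^{⊠N}) = O(3^{(1+ε)N})` for the small Coppersmith–Winograd tensor (the restriction
  `u(0,1,1) ≥ T_cw,2` over `ℂ`);
* `cwPointAssembly_proof` (Theorems/HessianPlaneCWPointAssembly.lean, item
  stmt-MatrixMultiplication-0589): that growth bound implies `MatrixMultiplication`, by the PROVED
  asymptotic-rank form of the Coppersmith–Winograd 1990 easy construction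
  (`CoppersmithWinograd1990_asymptoticRank_form_holds`, `q = 2`, `ρ = 3`) and `2 ≤ ω(ℂ)`.
This is exactly the route's deciding theorem `closes h₁ h₂ h₃ = h₃ (h₂ h₁)` with `h₂`, `h₃`
discharged; no unproved named fact is assumed.
-/

namespace Summit.MatrixMultiplication.MatrixMultiplication.Theorems

-- single-conjunct summit: the canonical namespace `Summit.MatrixMultiplication.MatrixMultiplication`
-- (Sub = Summit, D-0017) necessarily repeats `MatrixMultiplication`; silence only that linter here.
set_option linter.dupNamespace false in
/-- **Assembly of route `HessianPlane` (stmt-MatrixMultiplication-4900), exact signature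
`HessianPlaneFlat → MatrixMultiplication`.** Flatness of asymptotic rank on the Hessian plane,
specialised to the CW point `(0,1,1)` (`hesseToCW_proof`: `u(0,1,1) ≥ T_cw,2`, so
`R(T_cw,2^{⊠N}) = O(3^{(1+ε)N})`), feeds the proved Coppersmith–Winograd 1990 asymptotic-rank
assembly (`cwPointAssembly_proof`: `ω(ℂ) ≤ log₂(4·3³/27) = 2 ≤ ω(ℂ)`).
[cite: ConnerGesmundoLandsbergVentura2022, Thm 1.1; AlmanLi2026 §7.1] -/
theorem hessianPlane_assembly_proof :
    Summit.MatrixMultiplication.MatrixMultiplication.Theses.HessianPlane.Assembly := by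
  unfold Summit.MatrixMultiplication.MatrixMultiplication.Theses.HessianPlane.Assembly
  intro hflat
  exact cwPointAssembly_proof (hesseToCW_proof hflat)

end Summit.MatrixMultiplication.MatrixMultiplication.Theorems
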